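import Summits.QuantumFields.YangMills.Theorems.UnitScaleTiltProp7StubEXOfChartPiecesTwSR
import Summits.QuantumFields.YangMills.Theorems.UnitScaleTiltProp7Prop6RealSolution
import Summits.QuantumFields.YangMills.Theorems.UnitScaleTiltProp7SectET3JcurReality
import HarnessLib

/-!
# Route `UnitScaleTilt`, crux K1 child «MinimiserStabilityRegPr» (stmt-QuantumFields-19200), skeleton v10, stub `stub_existenceMinimalOrbit` (EX), route (α) — **THE
# REALITY ROW (R-A₁) OF THE EX KNIT v2.9ˢ FROM THE REALITY OF THE OPAQUE LETTERS** (knit ruler ★w2-19200 g3's NEXT (i), 2026-08-28): the displayed hypothesis `hA₁R` of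
# ✓`Prop7StubEXOfChartPiecesTwSR.stubEX_of_chartPiecesTwSR` («every solution `A₁` of (111) in the `r`-ball is `𝔤`-valued») is SUPPLIED, verbatim, from two one-line reality rows
# about the opaque letters `𝔊(U₀)` and `(δ∕δA′)V` (N06 ∕ P4 class), the knit's own rows `norm_G`, `prop4`, `norm_H₁`, `hH₁R`, (WF) `hWε`, and three `L`-only windows putting the
# radius `r` inside Prop. 6's uniqueness regime — by ✓`Prop7Prop6RealSolution.solution_mem_of_invariant_T3` (Prop. 6's contraction (116) run inside the closed real subspace of
# Hermitian-traceless (115)-fields) with the current's reality ✓`Prop7SectET3JcurReality.Jcur_bgOfCfg_mem_hermitianTraceless` and the pinned datum's reality (R-B)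
# ✓`Prop7StubEXOfChartPiecesTwSR.bsym_isHermitian_trace_zero`.

Cell `ym3-torus`, width seat `ym-ust-19200-w2` (gen 4).  THEOREMS ONLY (0 `def`, 0 `sorry`).  CONDITIONAL plumbing: nothing here closes the stub — the letter rows stay
displayed for the N06 ∕ ym-inputs desks; `--supports stmt-QuantumFields-19200 --as helper`, count-neutral.  YM₃ on T³ is a ladder rung (R3), not the Clay problem;
nothing here claims the stub, the crux, d = 4 or the mass gap.

THE PRINT.  [Balaban1985Variational] p. 295, Prop. 6: «Eq. (111) has exactly one solution in the space (115) … A solution of Eq. (111) is a fixed point of the transformation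
A₁ → −𝔊J − 𝔊((δ∕δA′)V)(A₁ + H₁B) (116)»; p. 286 (51): «We consider configurations A′, X with values in the complexified Lie algebra 𝔤ᶜ … for A′ with values in 𝔤 the
configuration D(A′) has values in 𝔤 also» — the same mechanism one storey down: the real letters `𝔊(U₀) = G₁(U₀)𝔓(U₀)*` ((103) p. 293), `(δ∕δA′)V` (Prop. 4 p. 293) and the
real current `J(U₀)` ((28) p. 282) map `𝔤`-valued data to `𝔤`-valued fields, so the contraction (116) preserves the closed real subspace of `𝔤`-valued fields and its
unique fixed point lies there.  For `G = SU(2)`: `𝔤 = 𝔰𝔲(2)` = `i`·(Hermitian traceless), and the route's (115)-coordinates `A₁` are the Hermitian-traceless ones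
(exponent `iη·ι A₁`).

WHAT IS PROVED (sorry-free, no definition).  ★★ **`hA₁R_of_letterReality`** — CONCLUSION = the knit's displayed row `hA₁R` VERBATIM (∀ `L > 1`, ∀ member `i`, ∀ `ε₁ V U₀` in
the knit's windows, every `A₁` with `‖A₁‖ < r L` solving (111) at `𝔄 = H₁(U₀)B^{sym}` has `ι A₁ b′` Hermitian and traceless at every bond); HYPOTHESES = the knit's `norm_G`,
`prop4`, `norm_H₁`, `hWε`, `hH₁R` verbatim, the two NEW letter rows (R-𝒢) `h𝒢R` («`𝔊(U₀)` maps Hermitian-traceless (−3)-data to Hermitian-traceless (115)-fields») and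
(R-W) `hWR` («`(δ∕δA′)V` maps Hermitian-traceless (115)-fields of the `a₃`-ball to Hermitian-traceless (−3)-data»), and the windows `2·B₀·α ≤ r`, `4·r ≤ a₃`,
`16·B₀·C₄·r ≤ 1` (so that `ε₄ := r` satisfies (118)∕(121): `2B₀C₁B₃ε₁ ≤ ε₄`, `4ε₄ ≤ a₃`, `16B₀C₄ε₄ ≤ 1` at `C₁B₃ε₁ = L³·3L·ε₁ ≤ α`).
HONEST SCOPE: fixed-point plumbing at the T³ objects; the reality of the letters is displayed, nothing of [B11] Props 4–6 or [B9] is asserted.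

References: T. Bałaban, CMP 102 (1985) 277–309 [Balaban1985Variational] ((28) p.282, (51) p.286, (103) p.293, (111)–(112) p.294, (115)–(121) p.295, Prop. 6 p.295,
(20) p.281); CMP 99 (1985) 389–434 [Balaban1985BackgroundPropagators] ((3.11) p.392).
-/

set_option autoImplicit false

noncomputable section

open Metric Set
open scoped BigOperators Matrix.Norms.L2Operator Matrix

namespace Summit.QuantumFields.YangMills.Theorems.Prop7SolutionRealityRowS

open NormedSpace
open Literature.MathematicalPhysics.QuantumFieldTheory.Balaban1983to89
open Literature.MathematicalPhysics.QuantumFieldTheory.Balaban1983to89.T3ContinuumYM3Torus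
open Literature.MathematicalPhysics.QuantumFieldTheory.Balaban1983to89.T3UnitLawDensityEML (ℰp)
open Literature.MathematicalPhysics.QuantumFieldTheory.Balaban1983to89.T3TiltDescent (descendTo)
open Literature.MathematicalPhysics.QuantumFieldTheory.Balaban1983to89.T3PrintedRegularMinimiser (RegPr)
open Literature.MathematicalPhysics.QuantumFieldTheory.Balaban1983to89.T3PrintedMinimiserExistence (regPr_mono)
open Literature.MathematicalPhysics.QuantumFieldTheory.Balaban1983to89.T3Thm1Carrier
open Literature.MathematicalPhysics.QuantumFieldTheory.Balaban1983to89.T3SectALandauChart (CloseAvg)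
open B9SectCLatticeCarrier (Bond)
open B11Eq115Space (NegSup NegSize Space115 JetSup levWeight)
open B11Eq111FrakG (nabla115)
open B11Eq98CurrentSlot (Jcur)
open B13Contraction113 (QuadAnalytic)
open MatrixLog (mlog)
open Summit.QuantumFields.YangMills.Theorems.Prop7SectET3Transport (periodsT3 siteEquiv siteEquiv_shiftEquiv bgOfCfg bondEquiv)
open Summit.QuantumFields.YangMills.Theorems.Prop7Bound20SymLog (bound20_symLog_of_closeAvg)
open Summit.QuantumFields.YangMills.Theorems.Prop7StubEXOfChartPiecesTwSR (bsym_isHermitian_trace_zero)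
open Summit.QuantumFields.YangMills.Theorems.Prop7Prop6RealSolution (solution_mem_of_invariant_T3)
open Summit.QuantumFields.YangMills.Theorems.Prop7SectET3JcurReality (isHermitian_trace_zero_Jcur_bgOfCfg)

/-- ★★ **THE KNIT'S ROW (R-A₁) FROM THE REALITY OF THE LETTERS**: with the knit's rows `norm_G`, `prop4`, `norm_H₁`, (WF) `hWε`, `hH₁R`, the letter-reality rows (R-𝒢)
«`𝔊(U₀)` maps Hermitian-traceless (−3)-data to Hermitian-traceless (115)-fields» and (R-W) «`(δ∕δA′)V` maps Hermitian-traceless fields of the `a₃`-ball to Hermitian-traceless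
data», and the windows `2B₀α ≤ r`, `4r ≤ a₃`, `16B₀C₄r ≤ 1`: for every `L > 1`, member `i`, and `ε₁, V, U₀` with `PlaqSmall ε₁ V`, `U₀ ∈ 𝔘_k(L³·3L·ε₁)`,
`|Ū₀ − V| < L³ε₁`, `L³·3L·ε₁ ≤ α`, EVERY `A₁` with `‖A₁‖ < r` and `A₁ + 𝔊J(U₀) + 𝔊((δ∕δA′)V)(A₁ + H₁B^{sym}) = 0` is Hermitian-traceless at every bond — Prop. 6's unique
fixed point of (116) lies in the closed real subspace the real letters preserve (✓`solution_mem_of_invariant_T3`), `J(U₀)` being Hermitian-traceless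
(✓`Jcur_bgOfCfg_mem_hermitianTraceless`) and `𝔄 = H₁B^{sym}` too (`hH₁R` ∘ ✓`bsym_isHermitian_trace_zero`, `‖𝔄‖ < 2·3L·B₀·L³ε₁` by `norm_H₁` ∘ ✓`bound20_symLog_of_closeAvg`).
This is the displayed hypothesis `hA₁R` of ✓`stubEX_of_chartPiecesTwSR`, verbatim.
[cite: Balaban1985Variational, Prop. 6 p.295, (116) p.295, (118)-(121) p.295, (51) p.286, (111) p.294, (103) p.293, (28) p.282, (20) p.281] -/
theorem hA₁R_of_letterReality
    [hFL : ∀ F : T3Family, Fact (0 < (F.L : ℝ))] [hFη : ∀ (F : T3Family) (k : ℕ), Fact (0 < ((F.L : ℝ)⁻¹) ^ k)]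
    (B₀ C₄ a₃ α r : ℕ → ℝ) (hB₀ : ∀ L, 1 < L → 0 < B₀ L) (hC₄ : ∀ L, 1 < L → 0 < C₄ L)
    -- the curved letters `𝔊(U₀)`, `(δ/δA′)V`, `H₁(U₀)`, OPAQUE (the knit's binders verbatim)
    (𝒢f : ∀ (L : ℕ) (i : Idx L) (U₀ : GaugeField (i.1.1.P i.1.2.2) 0 (Matrix.specialUnitaryGroup (Fin 2) ℂ)),
      NegSize (i.1.1.L : ℝ) (((i.1.1.L : ℝ)⁻¹) ^ (i.1.2.2 - i.1.2.1)) (fun _ : Bond 3 (periodsT3 i.1.1 i.1.2.2) => i.1.2.2 - i.1.2.1) 3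
          (Matrix (Fin 2) (Fin 2) ℂ) →L[ℂ]
        Space115 (i.1.1.L : ℝ) (((i.1.1.L : ℝ)⁻¹) ^ (i.1.2.2 - i.1.2.1)) (fun _ : Bond 3 (periodsT3 i.1.1 i.1.2.2) => i.1.2.2 - i.1.2.1)
          (fun _ : Bond 3 (periodsT3 i.1.1 i.1.2.2) × Fin 3 => i.1.2.2 - i.1.2.1) (nabla115 (((i.1.1.L : ℝ)⁻¹) ^ (i.1.2.2 - i.1.2.1)) (bgOfCfg i.1.1 i.1.2.2 U₀)))
    (Wf : ∀ (L : ℕ) (i : Idx L) (U₀ : GaugeField (i.1.1.P i.1.2.2) 0 (Matrix.specialUnitaryGroup (Fin 2) ℂ)),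
      Space115 (i.1.1.L : ℝ) (((i.1.1.L : ℝ)⁻¹) ^ (i.1.2.2 - i.1.2.1)) (fun _ : Bond 3 (periodsT3 i.1.1 i.1.2.2) => i.1.2.2 - i.1.2.1)
          (fun _ : Bond 3 (periodsT3 i.1.1 i.1.2.2) × Fin 3 => i.1.2.2 - i.1.2.1) (nabla115 (((i.1.1.L : ℝ)⁻¹) ^ (i.1.2.2 - i.1.2.1)) (bgOfCfg i.1.1 i.1.2.2 U₀)) →
        NegSize (i.1.1.L : ℝ) (((i.1.1.L : ℝ)⁻¹) ^ (i.1.2.2 - i.1.2.1)) (fun _ : Bond 3 (periodsT3 i.1.1 i.1.2.2) => i.1.2.2 - i.1.2.1) 3 (Matrix (Fin 2) (Fin 2) ℂ))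
    (H₁f : ∀ (L : ℕ) (i : Idx L) (U₀ : GaugeField (i.1.1.P i.1.2.2) 0 (Matrix.specialUnitaryGroup (Fin 2) ℂ)),
      (PBond (i.1.1.P i.1.2.1) 0 → Matrix (Fin 2) (Fin 2) ℂ) →L[ℂ]
        Space115 (i.1.1.L : ℝ) (((i.1.1.L : ℝ)⁻¹) ^ (i.1.2.2 - i.1.2.1)) (fun _ : Bond 3 (periodsT3 i.1.1 i.1.2.2) => i.1.2.2 - i.1.2.1)
          (fun _ : Bond 3 (periodsT3 i.1.1 i.1.2.2) × Fin 3 => i.1.2.2 - i.1.2.1) (nabla115 (((i.1.1.L : ℝ)⁻¹) ^ (i.1.2.2 - i.1.2.1)) (bgOfCfg i.1.1 i.1.2.2 U₀)))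
    -- their displayed bounds (the knit's rows verbatim)
    (norm_G : ∀ (L : ℕ), 1 < L → ∀ (i : Idx L) (ρ : ℝ) (U₀ : GaugeField (i.1.1.P i.1.2.2) 0 (Matrix.specialUnitaryGroup (Fin 2) ℂ)),
      RegPr i.1.1 i.1.2.1 i.1.2.2 ρ U₀ → ρ ≤ α L → ∀ f, ‖𝒢f L i U₀ f‖ ≤ B₀ L * ‖f‖)
    (prop4 : ∀ (L : ℕ), 1 < L → ∀ (i : Idx L) (ρ : ℝ) (U₀ : GaugeField (i.1.1.P i.1.2.2) 0 (Matrix.specialUnitaryGroup (Fin 2) ℂ)),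
      RegPr i.1.1 i.1.2.1 i.1.2.2 ρ U₀ → ρ ≤ α L → QuadAnalytic (Wf L i U₀) (C₄ L) (a₃ L))
    (norm_H₁ : ∀ (L : ℕ), 1 < L → ∀ (i : Idx L) (ρ : ℝ) (U₀ : GaugeField (i.1.1.P i.1.2.2) 0 (Matrix.specialUnitaryGroup (Fin 2) ℂ)),
      RegPr i.1.1 i.1.2.1 i.1.2.2 ρ U₀ → ρ ≤ α L → ∀ b, ‖H₁f L i U₀ b‖ ≤ B₀ L * ‖b‖)
    -- (WF) the regularity-radius numeral of the knit (verbatim; only `α ≤ 1` is used: `L³ε₁ ≤ α∕(3L) ≤ 1∕3`)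
    (hWε : ∀ L : ℕ, 1 < L → 10 ^ 12 * (L : ℝ) ^ 3 * α L ≤ 1)
    -- (R-𝒢) the letter `𝔊(U₀)` is REAL: Hermitian-traceless (−3)-data ↦ Hermitian-traceless (115)-fields (DISPLAYED, N06-class clause on the `norm_G` letter)
    (h𝒢R : ∀ (L : ℕ), 1 < L → ∀ (i : Idx L) (U₀ : GaugeField (i.1.1.P i.1.2.2) 0 (Matrix.specialUnitaryGroup (Fin 2) ℂ)), RegPr i.1.1 i.1.2.1 i.1.2.2 (α L) U₀ →
      ∀ f : NegSize (i.1.1.L : ℝ) (((i.1.1.L : ℝ)⁻¹) ^ (i.1.2.2 - i.1.2.1)) (fun _ : Bond 3 (periodsT3 i.1.1 i.1.2.2) => i.1.2.2 - i.1.2.1) 3 (Matrix (Fin 2) (Fin 2) ℂ),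
        (∀ b, (NegSup.equiv _ _ f b).IsHermitian ∧ (NegSup.equiv _ _ f b).trace = 0) →
        ∀ b, (JetSup.equiv _ _ _ (𝒢f L i U₀ f) b).IsHermitian ∧ (JetSup.equiv _ _ _ (𝒢f L i U₀ f) b).trace = 0)
    -- (R-W) the letter `(δ∕δA′)V` is REAL on its ball: Hermitian-traceless (115)-fields ↦ Hermitian-traceless (−3)-data (DISPLAYED, P4-class clause on the `prop4` letter)
    (hWR : ∀ (L : ℕ), 1 < L → ∀ (i : Idx L) (U₀ : GaugeField (i.1.1.P i.1.2.2) 0 (Matrix.specialUnitaryGroup (Fin 2) ℂ)), RegPr i.1.1 i.1.2.1 i.1.2.2 (α L) U₀ →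
      ∀ A : Space115 (i.1.1.L : ℝ) (((i.1.1.L : ℝ)⁻¹) ^ (i.1.2.2 - i.1.2.1)) (fun _ : Bond 3 (periodsT3 i.1.1 i.1.2.2) => i.1.2.2 - i.1.2.1)
          (fun _ : Bond 3 (periodsT3 i.1.1 i.1.2.2) × Fin 3 => i.1.2.2 - i.1.2.1) (nabla115 (((i.1.1.L : ℝ)⁻¹) ^ (i.1.2.2 - i.1.2.1)) (bgOfCfg i.1.1 i.1.2.2 U₀)),
        ‖A‖ < a₃ L → (∀ b, (JetSup.equiv _ _ _ A b).IsHermitian ∧ (JetSup.equiv _ _ _ A b).trace = 0) →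
        ∀ b, (NegSup.equiv _ _ (Wf L i U₀ A) b).IsHermitian ∧ (NegSup.equiv _ _ (Wf L i U₀ A) b).trace = 0)
    -- the three `L`-only windows putting `ε₄ := r` in Prop. 6's uniqueness regime (118)∕(121)
    (hrα : ∀ L : ℕ, 1 < L → 2 * B₀ L * α L ≤ r L) (hr4 : ∀ L : ℕ, 1 < L → 4 * r L ≤ a₃ L) (hr16 : ∀ L : ℕ, 1 < L → 16 * B₀ L * C₄ L * r L ≤ 1)
    -- (R-H₁) the letter `H₁(U₀)` is REAL (the knit's row verbatim)
    (hH₁R : ∀ (L : ℕ), 1 < L → ∀ (i : Idx L) (U₀ : GaugeField (i.1.1.P i.1.2.2) 0 (Matrix.specialUnitaryGroup (Fin 2) ℂ)), RegPr i.1.1 i.1.2.1 i.1.2.2 (α L) U₀ →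
      ∀ B : PBond (i.1.1.P i.1.2.1) 0 → Matrix (Fin 2) (Fin 2) ℂ, (∀ c, (B c).IsHermitian ∧ (B c).trace = 0) →
        ∀ b' : PBond (i.1.1.P i.1.2.2) 0, (JetSup.equiv _ _ _ (H₁f L i U₀ B) (bondEquiv i.1.1 i.1.2.2 b')).IsHermitian ∧
          (JetSup.equiv _ _ _ (H₁f L i U₀ B) (bondEquiv i.1.1 i.1.2.2 b')).trace = 0) :
    ∀ (L : ℕ), 1 < L → ∀ (i : Idx L) (ε₁ : ℝ) (V : GaugeField (i.1.1.P i.1.2.1) 0 (Matrix.specialUnitaryGroup (Fin 2) ℂ))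
      (U₀ : GaugeField (i.1.1.P i.1.2.2) 0 (Matrix.specialUnitaryGroup (Fin 2) ℂ)), 0 < ε₁ → PlaqSmall ε₁ V →
      RegPr i.1.1 i.1.2.1 i.1.2.2 ((L : ℝ) ^ 3 * (3 * (L : ℝ)) * ε₁) U₀ → CloseAvg i.1.1 i.1.2.1 i.1.2.2 i.2.2.le ((L : ℝ) ^ 3 * ε₁) V U₀ → (L : ℝ) ^ 3 * (3 * (L : ℝ)) * ε₁ ≤ α L →
      ∀ A₁ : Space115 (i.1.1.L : ℝ) (((i.1.1.L : ℝ)⁻¹) ^ (i.1.2.2 - i.1.2.1)) (fun _ : Bond 3 (periodsT3 i.1.1 i.1.2.2) => i.1.2.2 - i.1.2.1)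
          (fun _ : Bond 3 (periodsT3 i.1.1 i.1.2.2) × Fin 3 => i.1.2.2 - i.1.2.1) (nabla115 (((i.1.1.L : ℝ)⁻¹) ^ (i.1.2.2 - i.1.2.1)) (bgOfCfg i.1.1 i.1.2.2 U₀)),
        ‖A₁‖ < r L →
        A₁ + 𝒢f L i U₀ (Jcur (bgOfCfg i.1.1 i.1.2.2 U₀)) + 𝒢f L i U₀ (Wf L i U₀ (A₁ + H₁f L i U₀ (fun c : PBond (i.1.1.P i.1.2.1) 0 =>
          (-Complex.I) • mlog (((V c : Matrix.specialUnitaryGroup (Fin 2) ℂ) : Matrix (Fin 2) (Fin 2) ℂ)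
            * star ((descendTo i.1.1 ℰp i.1.2.1 i.1.2.2 i.2.2.le U₀ c : Matrix.specialUnitaryGroup (Fin 2) ℂ) : Matrix (Fin 2) (Fin 2) ℂ))))) = 0 →
        ∀ b' : PBond (i.1.1.P i.1.2.2) 0, (JetSup.equiv _ _ _ A₁ (bondEquiv i.1.1 i.1.2.2 b')).IsHermitian ∧ (JetSup.equiv _ _ _ A₁ (bondEquiv i.1.1 i.1.2.2 b')).trace = 0 := by
  intro L hL i ε₁ V U₀ hε₁ _hV hreg hclose hαe A₁ hA₁ hsol b'
  have hFL' : (i.1.1.L : ℝ) = (L : ℝ) := by exact_mod_cast i.2.1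
  have hL1 : (1 : ℝ) ≤ (L : ℝ) := by exact_mod_cast hL.le
  have hL0 : (0 : ℝ) < (L : ℝ) := by positivity
  have hB₀0 : 0 < B₀ L := hB₀ L hL
  have hC₄0 : 0 < C₄ L := hC₄ L hL
  -- the background at the window radius `α L`
  have hregα : RegPr i.1.1 i.1.2.1 i.1.2.2 (α L) U₀ := regPr_mono i.1.1 hαe hreg
  -- the numeric windows: `α ≤ 1`, `L³ε₁ ≤ 1∕3`, `0 < r`, the Prop. 6 regime at `ε₄ := r`
  have hρ0 : 0 < (L : ℝ) ^ 3 * (3 * (L : ℝ)) * ε₁ := by positivity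
  have hα1 : α L ≤ 1 := by
    have h1 : (1 : ℝ) ≤ 10 ^ 12 * (L : ℝ) ^ 3 := by
      have : (1 : ℝ) ≤ (L : ℝ) ^ 3 := one_le_pow₀ hL1
      nlinarith
    have h2 := hWε L hL
    have hα0 : 0 < α L := hρ0.trans_le hαe
    nlinarith
  have h13 : (i.1.1.L : ℝ) ^ 3 * ε₁ ≤ 1 / 3 := by
    rw [hFL']
    have h0 : 0 ≤ (L : ℝ) ^ 3 * ε₁ := by positivity
    have h3 : 3 * ((L : ℝ) ^ 3 * ε₁) ≤ (L : ℝ) ^ 3 * (3 * (L : ℝ)) * ε₁ := by nlinarith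
    nlinarith [hαe.trans hα1]
  have h12 : (i.1.1.L : ℝ) ^ 3 * ε₁ ≤ 1 / 2 := h13.trans (by norm_num)
  have h2B₀ρ : 2 * B₀ L * (L : ℝ) ^ 3 * (3 * (L : ℝ)) * ε₁ ≤ r L := by
    have h' : 2 * B₀ L * ((L : ℝ) ^ 3 * (3 * (L : ℝ)) * ε₁) ≤ 2 * B₀ L * α L := mul_le_mul_of_nonneg_left hαe (by positivity)
    have h'' : 2 * B₀ L * (L : ℝ) ^ 3 * (3 * (L : ℝ)) * ε₁ = 2 * B₀ L * ((L : ℝ) ^ 3 * (3 * (L : ℝ)) * ε₁) := by ring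
    rw [h'']
    exact h'.trans (hrα L hL)
  have hr0 : 0 < r L := lt_of_lt_of_le (by positivity) h2B₀ρ
  have hdLB₃ : (3 : ℝ) * i.1.1.L ≤ 3 * (L : ℝ) := by rw [hFL']
  -- (B20): the pinned datum is small, `‖B^{sym}‖ < 2·3L·L³ε₁`, and (R-B): it is Hermitian-traceless
  have hclose' : CloseAvg i.1.1 i.1.2.1 i.1.2.2 i.2.2.le ((i.1.1.L : ℝ) ^ 3 * ε₁) V U₀ := by rw [hFL']; exact hclose
  have hB := bound20_symLog_of_closeAvg i.1.1 i.2.2.le hε₁ h12 V U₀ hclose'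
  have hBR := bsym_isHermitian_trace_zero i.1.1 i.2.2.le V U₀ h13 hclose'
  -- the constant part `𝔄 = H₁B^{sym}`: size and reality
  have h𝔄 : ‖H₁f L i U₀ (fun c : PBond (i.1.1.P i.1.2.1) 0 =>
        (-Complex.I) • mlog (((V c : Matrix.specialUnitaryGroup (Fin 2) ℂ) : Matrix (Fin 2) (Fin 2) ℂ)
          * star ((descendTo i.1.1 ℰp i.1.2.1 i.1.2.2 i.2.2.le U₀ c : Matrix.specialUnitaryGroup (Fin 2) ℂ) : Matrix (Fin 2) (Fin 2) ℂ)))‖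
      < 2 * ((3 : ℝ) * i.1.1.L) * B₀ L * (L : ℝ) ^ 3 * ε₁ := by
    have h0 := norm_H₁ L hL i _ U₀ hreg hαe (fun c : PBond (i.1.1.P i.1.2.1) 0 =>
        (-Complex.I) • mlog (((V c : Matrix.specialUnitaryGroup (Fin 2) ℂ) : Matrix (Fin 2) (Fin 2) ℂ)
          * star ((descendTo i.1.1 ℰp i.1.2.1 i.1.2.2 i.2.2.le U₀ c : Matrix.specialUnitaryGroup (Fin 2) ℂ) : Matrix (Fin 2) (Fin 2) ℂ)))
    refine h0.trans_lt ?_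
    have h1 := mul_lt_mul_of_pos_left hB hB₀0
    have h2 : B₀ L * (2 * ((3 : ℝ) * i.1.1.L) * ((i.1.1.L : ℝ) ^ 3 * ε₁)) = 2 * ((3 : ℝ) * i.1.1.L) * B₀ L * (L : ℝ) ^ 3 * ε₁ := by rw [hFL']; ring
    rw [h2] at h1
    exact h1
  have h𝔄R : ∀ b : Bond 3 (periodsT3 i.1.1 i.1.2.2),
      (JetSup.equiv _ _ _ (H₁f L i U₀ (fun c : PBond (i.1.1.P i.1.2.1) 0 =>
        (-Complex.I) • mlog (((V c : Matrix.specialUnitaryGroup (Fin 2) ℂ) : Matrix (Fin 2) (Fin 2) ℂ)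
          * star ((descendTo i.1.1 ℰp i.1.2.1 i.1.2.2 i.2.2.le U₀ c : Matrix.specialUnitaryGroup (Fin 2) ℂ) : Matrix (Fin 2) (Fin 2) ℂ)))) b).IsHermitian ∧
      (JetSup.equiv _ _ _ (H₁f L i U₀ (fun c : PBond (i.1.1.P i.1.2.1) 0 =>
        (-Complex.I) • mlog (((V c : Matrix.specialUnitaryGroup (Fin 2) ℂ) : Matrix (Fin 2) (Fin 2) ℂ)
          * star ((descendTo i.1.1 ℰp i.1.2.1 i.1.2.2 i.2.2.le U₀ c : Matrix.specialUnitaryGroup (Fin 2) ℂ) : Matrix (Fin 2) (Fin 2) ℂ)))) b).trace = 0 := by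
    intro b
    have h := hH₁R L hL i U₀ hregα _ hBR ((bondEquiv i.1.1 i.1.2.2).symm b)
    rwa [Equiv.apply_symm_apply] at h
  -- the closed real subspace `S` of Hermitian-traceless (115)-fields and the real (−3)-data `T`
  let S : Submodule ℝ (Space115 (i.1.1.L : ℝ) (((i.1.1.L : ℝ)⁻¹) ^ (i.1.2.2 - i.1.2.1)) (fun _ : Bond 3 (periodsT3 i.1.1 i.1.2.2) => i.1.2.2 - i.1.2.1)
          (fun _ : Bond 3 (periodsT3 i.1.1 i.1.2.2) × Fin 3 => i.1.2.2 - i.1.2.1) (nabla115 (((i.1.1.L : ℝ)⁻¹) ^ (i.1.2.2 - i.1.2.1)) (bgOfCfg i.1.1 i.1.2.2 U₀))) :=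
    { carrier := {A | ∀ b, (JetSup.equiv _ _ _ A b).IsHermitian ∧ (JetSup.equiv _ _ _ A b).trace = 0}
      add_mem' := fun {A B} hA hB b => by
        refine ⟨?_, ?_⟩
        · rw [JetSup.equiv_add, Pi.add_apply]; exact (hA b).1.add (hB b).1
        · rw [JetSup.equiv_add, Pi.add_apply, Matrix.trace_add, (hA b).2, (hB b).2, add_zero]
      zero_mem' := fun b => by
        rw [JetSup.equiv_zero, Pi.zero_apply]; exact ⟨Matrix.isHermitian_zero, Matrix.trace_zero _ _⟩
      smul_mem' := fun c A hA b => by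
        rw [← Complex.coe_smul, JetSup.equiv_smul, Pi.smul_apply]
        refine ⟨?_, ?_⟩
        · have h1 := (hA b).1
          rw [Matrix.IsHermitian, Matrix.conjTranspose_smul, Complex.star_def, Complex.conj_ofReal, h1.eq]
        · rw [Matrix.trace_smul, (hA b).2, smul_zero] }
  have hSc : IsClosed (S : Set (Space115 (i.1.1.L : ℝ) (((i.1.1.L : ℝ)⁻¹) ^ (i.1.2.2 - i.1.2.1)) (fun _ : Bond 3 (periodsT3 i.1.1 i.1.2.2) => i.1.2.2 - i.1.2.1)
          (fun _ : Bond 3 (periodsT3 i.1.1 i.1.2.2) × Fin 3 => i.1.2.2 - i.1.2.1) (nabla115 (((i.1.1.L : ℝ)⁻¹) ^ (i.1.2.2 - i.1.2.1)) (bgOfCfg i.1.1 i.1.2.2 U₀)))) := by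
    have hcont : ∀ b : Bond 3 (periodsT3 i.1.1 i.1.2.2), Continuous fun A : Space115 (i.1.1.L : ℝ) (((i.1.1.L : ℝ)⁻¹) ^ (i.1.2.2 - i.1.2.1))
        (fun _ : Bond 3 (periodsT3 i.1.1 i.1.2.2) => i.1.2.2 - i.1.2.1) (fun _ : Bond 3 (periodsT3 i.1.1 i.1.2.2) × Fin 3 => i.1.2.2 - i.1.2.1)
        (nabla115 (((i.1.1.L : ℝ)⁻¹) ^ (i.1.2.2 - i.1.2.1)) (bgOfCfg i.1.1 i.1.2.2 U₀)) => JetSup.equiv _ _ _ A b :=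
      fun b => (JetSup.evalCLM (levWeight (i.1.1.L : ℝ) (((i.1.1.L : ℝ)⁻¹) ^ (i.1.2.2 - i.1.2.1)) (fun _ : Bond 3 (periodsT3 i.1.1 i.1.2.2) => i.1.2.2 - i.1.2.1) 1)
        (levWeight (i.1.1.L : ℝ) (((i.1.1.L : ℝ)⁻¹) ^ (i.1.2.2 - i.1.2.1)) (fun _ : Bond 3 (periodsT3 i.1.1 i.1.2.2) × Fin 3 => i.1.2.2 - i.1.2.1) 2)
        (nabla115 (((i.1.1.L : ℝ)⁻¹) ^ (i.1.2.2 - i.1.2.1)) (bgOfCfg i.1.1 i.1.2.2 U₀)) b).continuous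
    have hset : (S : Set (Space115 (i.1.1.L : ℝ) (((i.1.1.L : ℝ)⁻¹) ^ (i.1.2.2 - i.1.2.1)) (fun _ : Bond 3 (periodsT3 i.1.1 i.1.2.2) => i.1.2.2 - i.1.2.1)
          (fun _ : Bond 3 (periodsT3 i.1.1 i.1.2.2) × Fin 3 => i.1.2.2 - i.1.2.1) (nabla115 (((i.1.1.L : ℝ)⁻¹) ^ (i.1.2.2 - i.1.2.1)) (bgOfCfg i.1.1 i.1.2.2 U₀))))
        = ⋂ b, ({A | (JetSup.equiv _ _ _ A b)ᴴ = JetSup.equiv _ _ _ A b} ∩ {A | (JetSup.equiv _ _ _ A b).trace = 0}) := by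
      ext A
      simp only [mem_iInter, mem_inter_iff, mem_setOf_eq]
      exact Iff.rfl
    rw [hset]
    refine isClosed_iInter fun b => IsClosed.inter ?_ ?_
    · exact isClosed_eq (hcont b).matrix_conjTranspose (hcont b)
    · exact isClosed_eq ((hcont b).matrix_trace) continuous_const
  -- Prop. 6's unique solution lies in `S` (✓`solution_mem_of_invariant_T3` at `C₁ := L³`, `B₃ := 3L`, `ε₄ := r L`)
  have key := solution_mem_of_invariant_T3 (n := i.1.2.1) (siteEquiv i.1.1 i.1.2.2) (siteEquiv_shiftEquiv i.1.1 i.1.2.2)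
    (C₁ := (L : ℝ) ^ 3) (B₃ := 3 * (L : ℝ)) (ε₄ := r L) U₀ (𝒢 := 𝒢f L i U₀) (W := Wf L i U₀)
    (norm_G L hL i _ U₀ hreg hαe) (prop4 L hL i _ U₀ hreg hαe) hB₀0 hC₄0 (by positivity) (by positivity) hε₁ hdLB₃ h2B₀ρ (hr4 L hL) (hr16 L hL) hreg
    (𝔄 := H₁f L i U₀ (fun c : PBond (i.1.1.P i.1.2.1) 0 =>
        (-Complex.I) • mlog (((V c : Matrix.specialUnitaryGroup (Fin 2) ℂ) : Matrix (Fin 2) (Fin 2) ℂ)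
          * star ((descendTo i.1.1 ℰp i.1.2.1 i.1.2.2 i.2.2.le U₀ c : Matrix.specialUnitaryGroup (Fin 2) ℂ) : Matrix (Fin 2) (Fin 2) ℂ))))
    h𝔄 S hSc {f | ∀ b, (NegSup.equiv _ _ f b).IsHermitian ∧ (NegSup.equiv _ _ f b).trace = 0}
    (fun f hf => h𝒢R L hL i U₀ hregα f hf)
    (fun b => isHermitian_trace_zero_Jcur_bgOfCfg (n := i.1.2.1) U₀ b)
    (fun X hX hXn => by
      refine hWR L hL i U₀ hregα _ ?_ (S.add_mem hX h𝔄R)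
      have h3r : 2 * ((3 : ℝ) * i.1.1.L) * B₀ L * (L : ℝ) ^ 3 * ε₁ ≤ r L := by
        rw [hFL']
        have : 2 * ((3 : ℝ) * (L : ℝ)) * B₀ L * (L : ℝ) ^ 3 * ε₁ = 2 * B₀ L * (L : ℝ) ^ 3 * (3 * (L : ℝ)) * ε₁ := by ring
        rw [this]; exact h2B₀ρ
      calc ‖X + _‖ ≤ ‖X‖ + ‖_‖ := norm_add_le _ _
        _ < r L + r L := add_lt_add_of_le_of_lt hXn (h𝔄.trans_le h3r)
        _ ≤ a₃ L := by linarith [hr4 L hL])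
    A₁ hA₁ hsol
  exact key (bondEquiv i.1.1 i.1.2.2 b')

end Summit.QuantumFields.YangMills.Theorems.Prop7SolutionRealityRowS

end
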